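import Literature.Computability.Cryptography.ChenQuantumLWEProductProofs

/-!
# The output law of Chen's Step 9: `u[1..n]` is exactly uniform, whatever is done to coordinate 0

REPRODUCTION / ANALYSIS OF A CLAIMED RESULT UNDER ADJUDICATION (withdrawn): Yilei Chen, *Quantum
Algorithms for Lattice Problems*, IACR ePrint 2024/555, version of 2024-04-18 [ChenQuantumLattice2024],
Step 9 (§3.5.9, pp. 34–38); see `ChenQuantumLWESteps.lean` for the author's withdrawal notes.
Bundle `papers/QuantumAdvantage/lwe-quantum-autopsy/` (Part 1), companion of `STEPS.md` §4.4(c) and of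
`REPAIR-CENSUS.md` T2 (Part 2).  HONEST FRAMING: kernel-checked THEOREMS about the measurement statistics
of a WITHDRAWN algorithm — a precise negative result, NOT summit progress, no cryptanalytic claim.

Content.  After Step 8 and the swap (9.c)–(9.d), Chen's state is `|φ8.f⟩` (eq. (40)), a product state
`|A⟩ ⊗ |B⟩` across (coordinate 0) ⊗ (coordinates 1..n) (`ChenQuantumLWEProductProofs`).  Here:
* `Certificate.headKet`, `Certificate.tailKet`, `Certificate.splitFirst_ket` — the two factors of a
  CRT-certified chirped line EXPLICITLY, and the factorisation as an equation (not just `IsProduct`).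
* `qftTail` — `QFT_{ℤ_Nⁿ}` applied to coordinates `1..n` of a bipartite amplitude function (Chen's sign
  convention, unnormalised); `splitFirst_qft` — the full `QFT_{ℤ_N^{n+1}}` of `ChenQuantumLWESteps.qft` is
  `qftTail` after the coordinate-0 Fourier kernel, so a kernel `K` on coordinate 0 absorbs BOTH Chen's
  operations (9.e)–(9.g) (any linear processing of coordinate 0: unitaries, ancillas, measurement branches,
  change of modulus) AND the coordinate-0 part of the final `QFT` (9.h).
* `tail_fourier_norm_sq` — every Fourier coefficient of the `|B⟩` factor of `|φ8.f⟩` has squared modulus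
  EXACTLY `Q` (`Q = p₂⋯p_κ` odd, `gcd(p₁,Q)=1`, `p₁ ∣ b*ᵢ`): it is a root of unity times a quadratic Gauss
  sum modulo `Q` with unit leading coefficient `-β`, `βp₁ ≡ 1 (mod Q)`
  (`Literature.NumberTheory.GaussSums.norm_sq_sum_stdAddChar_quadratic`).
* `Shape.outputWeight_eq` — THE OUTPUT LAW: for every admissible shape and EVERY kernel `K` on coordinate 0,
  the unnormalised Born weight of the final outcome `(x', u')` is `w(x') · Q`: it does not depend on
  `u' = u[1..n]` at all.  Hence `u[1..n]` is exactly uniform and independent of register 0, and the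
  statistics carry no information about the LWE secret through `u[1..n]`; Chen's eq. (41) (claimed to hold
  with certainty, Lemma 3.8 p. 38) is a non-trivial linear condition on `u'` modulo `Q` and so cannot hold
  with probability 1 (`STEPS.md` §4.4(d): probability exactly `1/Q`; that last counting step is not
  formalised here).

Not here: normalisation of states, the probability `1/Q` of eq. (41), and anything about Steps 1–8.
-/

namespace Literature.Computability.Cryptography.Chen2024

open scoped BigOperators

/-! ### Generic helpers -/

/-- `‖e(q)‖ = 1`. [folklore] -/
theorem norm_e (q : ℚ) : ‖e q‖ = 1 := by
  have h : (2 * Real.pi * Complex.I * (q : ℂ)) = ((2 * Real.pi * q : ℝ) : ℂ) * Complex.I := by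
    push_cast
    ring
  rw [e, h, Complex.norm_exp_ofReal_mul_I]

/-- `e(q + q') = e(q) e(q')`. [folklore] -/
theorem e_add (q q' : ℚ) : e (q + q') = e q * e q' := by
  rw [e, e, e, ← Complex.exp_add]
  congr 1
  push_cast
  ring

/-- Change of modulus in the standard additive character: `ψ_M(c·w) = ψ_m(w)` when `M = c·m`
(`e(cw/(cm)) = e(w/m)`). [folklore] -/
theorem stdAddChar_intCast_mul (M m : ℕ) [NeZero M] [NeZero m] (c w : ℤ) (hM : (M : ℤ) = c * m) :
    ZMod.stdAddChar ((c * w : ℤ) : ZMod M) = ZMod.stdAddChar ((w : ℤ) : ZMod m) := by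
  have hc : c ≠ 0 := by
    rintro rfl
    rw [zero_mul] at hM
    exact NeZero.ne M (by exact_mod_cast hM)
  rw [← e_intCast_div_eq_stdAddChar, ← e_intCast_div_eq_stdAddChar]
  congr 1
  have hMQ : ((M : ℕ) : ℚ) = (c : ℚ) * (m : ℚ) := by exact_mod_cast hM
  rw [hMQ]
  push_cast
  rw [mul_div_mul_left _ _ (by exact_mod_cast hc : (c : ℚ) ≠ 0)]

/-- `e(-d/N) = ψ_N(-d)` for a natural number `d`. [folklore] -/
theorem e_neg_natCast_div (N : ℕ) [NeZero N] (d : ℕ) :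
    e (-(((d : ℕ) : ℚ) / N)) = ZMod.stdAddChar (-((d : ℕ) : ZMod N)) := by
  have h : (-(((d : ℕ) : ℚ) / N)) = (((-(d : ℤ)) : ℤ) : ℚ) / N := by
    push_cast
    ring
  rw [h, e_intCast_div_eq_stdAddChar]
  congr 1
  push_cast
  ring

/-- Reindex a sum over `[0, m)` as a sum over `ZMod m`. [folklore] -/
theorem sum_range_eq_sum_zmod (m : ℕ) [NeZero m] (g : ZMod m → ℂ) :
    ∑ k ∈ Finset.range m, g (k : ZMod m) = ∑ x : ZMod m, g x := by
  refine Finset.sum_nbij' (fun k : ℕ => (k : ZMod m)) (fun x : ZMod m => x.val)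
    (fun k _ => Finset.mem_univ _) (fun x _ => Finset.mem_range.2 (ZMod.val_lt x))
    (fun k hk => ?_) (fun x _ => ?_) (fun k _ => rfl)
  · exact ZMod.val_cast_of_lt (Finset.mem_range.1 hk)
  · exact ZMod.natCast_zmod_val x

/-- Collapsing a sum against a family of basis vectors: `Σ_y (Σ_{k∈s} [y = B k] f k) g y = Σ_{k∈s} f k g (B k)`.
[folklore] -/
theorem sum_ite_family_mul {β : Type*} [Fintype β] [DecidableEq β] (s : Finset ℕ) (B : ℕ → β)
    (f : ℕ → ℂ) (g : β → ℂ) :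
    ∑ y, (∑ k ∈ s, if y = B k then f k else 0) * g y = ∑ k ∈ s, f k * g (B k) := by
  simp_rw [Finset.sum_mul, ite_mul, zero_mul]
  rw [Finset.sum_comm]
  exact Finset.sum_congr rfl fun k _ => Fintype.sum_ite_eq' (B k) fun y => f k * g y

/-- Chen's exponent `⟨y, u⟩` read on canonical representatives (as in `qft`, Lemma 2.12).
[cite: ChenQuantumLattice2024, Lemma 2.12 p. 12] -/
def dotVal {n N : ℕ} (y u : Fin n → ZMod N) : ℕ := ∑ t, (y t).val * (u t).val

/-- `⟨y, u⟩` modulo `N` is the `ZMod N` inner product. [folklore] -/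
theorem natCast_dotVal {n N : ℕ} [NeZero N] (y u : Fin n → ZMod N) :
    ((dotVal y u : ℕ) : ZMod N) = ∑ t, y t * u t := by
  unfold dotVal
  push_cast
  simp

/-- `QFT_{ℤ_Nⁿ}` on coordinates `1..n` of a bipartite amplitude function `Ψ(x', y)` (unnormalised, sign
`-`, Lemma 2.12): `(x', u') ↦ Σ_y Ψ(x', y) e(-⟨y,u'⟩/N)`. [cite: ChenQuantumLattice2024, Lemma 2.12 p. 12] -/
noncomputable def qftTail {α : Type*} {n N : ℕ} [NeZero N] (Ψ : α × (Fin n → ZMod N) → ℂ) :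
    α × (Fin n → ZMod N) → ℂ :=
  fun z => ∑ y : Fin n → ZMod N, Ψ (z.1, y) * e (-(((dotVal y z.2 : ℕ) : ℚ) / N))

/-! ### The two factors of a certified chirped line, explicitly -/

namespace Certificate

variable {n : ℕ} {L : ChirpedLine n} {p₁ Q : ℕ}

/-- The coordinate-0 factor `|A⟩ = Σ_{k₁<p₁} e(θ₁(k₁)/P) |A k₁⟩` of a certified chirped line.
[cite: ChenQuantumLattice2024, eq. (40) p. 36] -/
noncomputable def headKet (C : Certificate L p₁ Q) : ZMod L.N → ℂ :=
  fun x => ∑ k₁ ∈ Finset.range p₁, if x = C.A k₁ then e (((C.θ₁ k₁).val : ℚ) / L.P) else 0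

/-- The coordinates-`1..n` factor `|B⟩ = Σ_{k₂<Q} e(θ₂(k₂)/P) |B k₂⟩` of a certified chirped line.
[cite: ChenQuantumLattice2024, eq. (40) p. 36] -/
noncomputable def tailKet (C : Certificate L p₁ Q) : (Fin n → ZMod L.N) → ℂ :=
  fun y => ∑ k₂ ∈ Finset.range Q, if y = C.B k₂ then e (((C.θ₂ k₂).val : ℚ) / L.P) else 0

/-- The factorisation as an EQUATION: `⟨x, y | L⟩ = headKet x · tailKet y` (same CRT reindexing as
`certificateGivesProduct_holds`). [cite: ChenQuantumLattice2024, eq. (40) p. 36 and the author's note p. 37] -/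
theorem splitFirst_ket (C : Certificate L p₁ Q) (x : ZMod L.N) (y : Fin n → ZMod L.N) :
    splitFirst L.ket (x, y) = C.headKet x * C.tailKet y := by
  have hP : (L.P : ℕ) = p₁ * Q := C.hP
  have hp₁ : p₁ ≠ 0 := by
    intro h; have := L.P.pos; rw [hP, h, zero_mul] at this; exact lt_irrefl 0 this
  have hQ : Q ≠ 0 := by
    intro h; have := L.P.pos; rw [hP, h, mul_zero] at this; exact lt_irrefl 0 this
  let F : ℕ → ℂ := fun k₁ => if x = C.A k₁ then e (((C.θ₁ k₁).val : ℚ) / L.P) else 0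
  let G : ℕ → ℂ := fun k₂ => if y = C.B k₂ then e (((C.θ₂ k₂).val : ℚ) / L.P) else 0
  have rhs : C.headKet x * C.tailKet y
      = ∑ kk ∈ Finset.range p₁ ×ˢ Finset.range Q, F kk.1 * G kk.2 := by
    show (∑ k₁ ∈ Finset.range p₁, F k₁) * (∑ k₂ ∈ Finset.range Q, G k₂) = _
    rw [Finset.sum_product, Finset.sum_mul_sum]
  rw [rhs]
  show L.ket (Fin.cons x y) = _
  unfold ChirpedLine.ket
  refine Finset.sum_nbij' (fun j : ZMod L.P => (j.val % p₁, j.val % Q))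
    (fun kk => ((Nat.chineseRemainder C.cop kk.1 kk.2 : ℕ) : ZMod L.P)) ?_ ?_ ?_ ?_ ?_
  · intro j _
    simp only [Finset.mem_product, Finset.mem_range]
    exact ⟨Nat.mod_lt _ (Nat.pos_of_ne_zero hp₁), Nat.mod_lt _ (Nat.pos_of_ne_zero hQ)⟩
  · intro kk _
    exact Finset.mem_univ _
  · intro j _
    have h := Nat.chineseRemainder_modEq_unique C.cop
      (Nat.mod_modEq j.val p₁).symm (Nat.mod_modEq j.val Q).symm
    rw [← hP] at h
    dsimp only
    rw [← (ZMod.natCast_eq_natCast_iff _ _ _).2 h, ZMod.natCast_zmod_val]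
  · rintro ⟨k₁, k₂⟩ hk
    simp only [Finset.mem_product, Finset.mem_range] at hk
    have hlt : (Nat.chineseRemainder C.cop k₁ k₂ : ℕ) < L.P := by
      rw [hP]; exact Nat.chineseRemainder_lt_mul C.cop k₁ k₂ hp₁ hQ
    have hval : ((Nat.chineseRemainder C.cop k₁ k₂ : ℕ) : ZMod L.P).val
        = (Nat.chineseRemainder C.cop k₁ k₂ : ℕ) := ZMod.val_cast_of_lt hlt
    simp only [hval, Prod.mk.injEq]
    exact ⟨Eq.trans ((Nat.chineseRemainder C.cop k₁ k₂).prop.1 :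
              (Nat.chineseRemainder C.cop k₁ k₂ : ℕ) % p₁ = k₁ % p₁) (Nat.mod_eq_of_lt hk.1),
           Eq.trans ((Nat.chineseRemainder C.cop k₁ k₂).prop.2 :
              (Nat.chineseRemainder C.cop k₁ k₂ : ℕ) % Q = k₂ % Q) (Nat.mod_eq_of_lt hk.2)⟩
  · intro j _
    simp only [F, G, cons_eq_iff, C.head j, C.tail j, C.phase j, e_val_add]
    by_cases h1 : x = C.A (j.val % p₁) <;> by_cases h2 : y = C.B (j.val % Q) <;> simp [h1, h2]

end Certificate

/-! ### The Fourier coefficients of the `|B⟩` factor of `|φ8.f⟩` all have squared modulus `Q` -/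

section TailFourier

variable (n : ℕ) (D p₁ Q : ℕ+) (bstar vstar : Fin (n + 1) → ℤ)
  (cop : Nat.Coprime p₁ Q) (hhead : (Q : ℤ) ∣ bstar 0) (htail : ∀ i, i ≠ 0 → (p₁ : ℤ) ∣ bstar i)


/-- **Uniform Fourier modulus of `|B⟩`.**  For Chen's `|φ8.f⟩` (`gcd(p₁,Q)=1`, `Q ∣ b*₀`, `p₁ ∣ b*ᵢ`,
`Q` odd, offsets arbitrary) and every `u' ∈ ℤ_Nⁿ`:
`|Σ_y ⟨y|B⟩ e(-⟨y,u'⟩/N)|² = Q`.  Proof: the sum collapses to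
`e(-⟨v*',u'⟩/N) · Σ_{k<Q} ψ_Q(-β k² - 2⟨c,u'⟩ k)` with `b*' = p₁ c`, `β = Nat.gcdA p₁ Q`
(`βp₁ ≡ 1 mod Q`, so `-β` is a unit), a quadratic Gauss sum of squared modulus `Q`.
[cite: ChenQuantumLattice2024, §3.5.9 p. 38 (the claimed law after `QFT`)] -/
theorem tail_fourier_norm_sq (hQ : Odd (Q : ℕ)) (u : Fin n → ZMod (phi8fLine n D p₁ Q bstar vstar).N) :
    ‖∑ y, (phi8fCertificate n D p₁ Q bstar vstar cop hhead htail).tailKet y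
        * e (-(((dotVal y u : ℕ) : ℚ) / (phi8fLine n D p₁ Q bstar vstar).N))‖ ^ 2 = Q := by
  -- slopes of coordinates 1..n are p₁ · c t
  choose c hc using fun t : Fin n => htail (Fin.succ t) (Fin.succ_ne_zero t)
  have hPZ : ((((phi8fLine n D p₁ Q bstar vstar).P : ℕ)) : ℤ) = (p₁ : ℤ) * (Q : ℤ) := by
    show ((((p₁ * Q : ℕ+)) : ℕ) : ℤ) = _
    push_cast
    ring
  have hNZ : ((((phi8fLine n D p₁ Q bstar vstar).N : ℕ)) : ℤ) = ((D : ℤ) ^ 2 * p₁) * (Q : ℤ) := by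
    show ((((D * D * (p₁ * Q) : ℕ+)) : ℕ) : ℤ) = _
    push_cast
    ring
  -- integer data of the outcome `u`
  set w : ℤ := ∑ t, c t * ((u t).val : ℤ) with hw
  set V : ℤ := ∑ t, vstar (Fin.succ t) * ((u t).val : ℤ) with hV
  -- the Gauss-sum coefficients
  set a : ZMod Q := -((Nat.gcdA p₁ Q : ℤ) : ZMod Q) with ha_def
  set b : ZMod Q := -(2 * (w : ZMod Q)) with hb_def
  have ha : IsUnit a := by
    have hbz := congrArg (fun z : ℤ => (z : ZMod Q)) (bezout_of_coprime cop)
    simp only [Int.cast_add, Int.cast_mul, Int.cast_natCast, ZMod.natCast_self, mul_zero, zero_add,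
      Int.cast_one] at hbz
    rw [ha_def]
    exact (IsUnit.of_mul_eq_one _ hbz).neg
  -- Step 1: collapse the sum over `y`
  have step1 : (∑ y, (phi8fCertificate n D p₁ Q bstar vstar cop hhead htail).tailKet y
        * e (-(((dotVal y u : ℕ) : ℚ) / (phi8fLine n D p₁ Q bstar vstar).N)))
      = ∑ k ∈ Finset.range (Q : ℕ),
          e ((((phi8fCertificate n D p₁ Q bstar vstar cop hhead htail).θ₂ k).val : ℚ)
              / (phi8fLine n D p₁ Q bstar vstar).P)
          * e (-(((dotVal ((phi8fCertificate n D p₁ Q bstar vstar cop hhead htail).B k) u : ℕ) : ℚ)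
              / (phi8fLine n D p₁ Q bstar vstar).N)) :=
    sum_ite_family_mul (Finset.range (Q : ℕ)) (phi8fCertificate n D p₁ Q bstar vstar cop hhead htail).B _ _
  -- Step 2: each summand is `e(-V/N) · ψ_Q(a k² + b k)`
  have step2 : ∀ k ∈ Finset.range (Q : ℕ),
      e ((((phi8fCertificate n D p₁ Q bstar vstar cop hhead htail).θ₂ k).val : ℚ)
              / (phi8fLine n D p₁ Q bstar vstar).P)
          * e (-(((dotVal ((phi8fCertificate n D p₁ Q bstar vstar cop hhead htail).B k) u : ℕ) : ℚ)
              / (phi8fLine n D p₁ Q bstar vstar).N))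
        = e (((-V : ℤ) : ℚ) / (phi8fLine n D p₁ Q bstar vstar).N)
          * ZMod.stdAddChar (a * ((k : ℕ) : ZMod Q) ^ 2 + b * ((k : ℕ) : ZMod Q)) := by
    intro k _
    -- the chirp: `e(θ₂(k)/P) = ψ_Q(-β k²)`
    have hθ : e ((((phi8fCertificate n D p₁ Q bstar vstar cop hhead htail).θ₂ k).val : ℚ) / (phi8fLine n D p₁ Q bstar vstar).P)
        = ZMod.stdAddChar (((-((Nat.gcdA p₁ Q : ℤ) * ((k : ℕ) : ℤ) ^ 2)) : ℤ) : ZMod Q) := by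
      rw [e_val_div_eq_stdAddChar]
      have h1 : (phi8fCertificate n D p₁ Q bstar vstar cop hhead htail).θ₂ k
          = ((((p₁ : ℤ)) * (-((Nat.gcdA p₁ Q : ℤ) * ((k : ℕ) : ℤ) ^ 2)) : ℤ) : ZMod (phi8fLine n D p₁ Q bstar vstar).P) := by
        show (((-((Nat.gcdA p₁ Q : ℤ) * p₁ * ((k : ℕ) : ℤ) ^ 2)) : ℤ) : ZMod (phi8fLine n D p₁ Q bstar vstar).P) = _
        congr 1
        ring
      rw [h1]
      exact stdAddChar_intCast_mul _ _ _ _ hPZ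
    -- the point: `⟨B k, u⟩ ≡ D²p₁ · (2 k w) + V (mod N)`
    have hdot : ((dotVal ((phi8fCertificate n D p₁ Q bstar vstar cop hhead htail).B k) u : ℕ) :
          ZMod (phi8fLine n D p₁ Q bstar vstar).N)
        = (((((D : ℤ) ^ 2 * p₁) * (2 * ((k : ℕ) : ℤ) * w) + V : ℤ)) :
          ZMod (phi8fLine n D p₁ Q bstar vstar).N) := by
      rw [natCast_dotVal]
      have hB : ∀ t, (phi8fCertificate n D p₁ Q bstar vstar cop hhead htail).B k t * u t
          = (((2 * (D : ℤ) ^ 2 * ((k : ℕ) : ℤ) * (p₁ * c t) + vstar (Fin.succ t) : ℤ) :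
              ZMod (phi8fLine n D p₁ Q bstar vstar).N)) * u t := by
        intro t
        have hBt : (phi8fCertificate n D p₁ Q bstar vstar cop hhead htail).B k t
            = ((2 * (D : ℤ) ^ 2 * ((k : ℕ) : ℤ) * bstar (Fin.succ t)
                + vstar (Fin.succ t) : ℤ) : ZMod (phi8fLine n D p₁ Q bstar vstar).N) := rfl
        rw [hBt, hc t]
      rw [Finset.sum_congr rfl fun t _ => hB t, hw, hV]
      push_cast [ZMod.natCast_zmod_val]
      simp only [Finset.mul_sum, ← Finset.sum_add_distrib]
      refine Finset.sum_congr rfl fun t _ => ?_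
      ring
    have hsplit : (-((((((D : ℤ) ^ 2 * p₁) * (2 * ((k : ℕ) : ℤ) * w) + V : ℤ)) : ZMod (phi8fLine n D p₁ Q bstar vstar).N)))
        = (((((D : ℤ) ^ 2 * p₁) * (-(2 * ((k : ℕ) : ℤ) * w)) : ℤ)) : ZMod (phi8fLine n D p₁ Q bstar vstar).N)
          + (((-V : ℤ)) : ZMod (phi8fLine n D p₁ Q bstar vstar).N) := by
      push_cast
      ring
    rw [hθ, e_neg_natCast_div, hdot, hsplit, AddChar.map_add_eq_mul,
      stdAddChar_intCast_mul _ _ _ _ hNZ, ← e_intCast_div_eq_stdAddChar ((phi8fLine n D p₁ Q bstar vstar).N) (-V),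
      ← mul_assoc, ← AddChar.map_add_eq_mul]
    have hsum : ((((-((Nat.gcdA p₁ Q : ℤ) * ((k : ℕ) : ℤ) ^ 2)) : ℤ) : ZMod Q)
        + (((-(2 * ((k : ℕ) : ℤ) * w)) : ℤ) : ZMod Q))
        = a * ((k : ℕ) : ZMod Q) ^ 2 + b * ((k : ℕ) : ZMod Q) := by
      rw [ha_def, hb_def]
      push_cast
      ring
    rw [hsum, mul_comm]
  -- Step 3: Gauss sum
  have step3 : ∑ k ∈ Finset.range (Q : ℕ),
      ZMod.stdAddChar (a * ((k : ℕ) : ZMod Q) ^ 2 + b * ((k : ℕ) : ZMod Q))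
        = ∑ x : ZMod Q, ZMod.stdAddChar (a * x ^ 2 + b * x) :=
    sum_range_eq_sum_zmod Q (fun x => ZMod.stdAddChar (a * x ^ 2 + b * x))
  rw [step1, Finset.sum_congr rfl step2, ← Finset.mul_sum, step3, norm_mul, mul_pow, norm_e,
    one_pow, one_mul]
  exact Literature.NumberTheory.GaussSums.norm_sq_sum_stdAddChar_quadratic Q hQ a b ha

end TailFourier

/-! ### The output law -/

/-- For a certified chirped line and ANY kernel `K` on coordinate 0, `QFT` on coordinates `1..n` of the
processed state factors: `qftTail(K·L)(x',u') = (Σ_x K x' x · headKet x) · Σ_y tailKet y · e(-⟨y,u'⟩/N)`.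
[folklore] -/
theorem Certificate.qftTail_processed {n : ℕ} {L : ChirpedLine n} {p₁ Q : ℕ} (C : Certificate L p₁ Q)
    {α' : Type*} (K : α' → ZMod L.N → ℂ) (x' : α') (u' : Fin n → ZMod L.N) :
    qftTail (fun z : α' × (Fin n → ZMod L.N) => ∑ x, K z.1 x * splitFirst L.ket (x, z.2)) (x', u')
      = (∑ x, K x' x * C.headKet x) * ∑ y, C.tailKet y * e (-(((dotVal y u' : ℕ) : ℚ) / L.N)) := by
  have hfac : ∀ y : Fin n → ZMod L.N,
      (∑ x, K x' x * splitFirst L.ket (x, y)) = (∑ x, K x' x * C.headKet x) * C.tailKet y := by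
    intro y
    rw [Finset.sum_mul]
    refine Finset.sum_congr rfl fun x _ => ?_
    rw [C.splitFirst_ket x y, mul_assoc]
  simp only [qftTail]
  simp_rw [hfac, mul_assoc]
  rw [← Finset.mul_sum]

section OutputLaw

variable (n : ℕ) (D p₁ Q : ℕ+) (bstar vstar : Fin (n + 1) → ℤ)
  (cop : Nat.Coprime p₁ Q) (hhead : (Q : ℤ) ∣ bstar 0) (htail : ∀ i, i ≠ 0 → (p₁ : ℤ) ∣ bstar i)


/-- Output law for the line `|φ8.f⟩` with explicit data: the Born weight of `(x', u')` is
`‖Σ_x K x' x · headKet x‖² · Q`, independent of `u'`. [cite: ChenQuantumLattice2024, §3.5.9 p. 38] -/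
theorem phi8fLine_outputWeight (hQ : Odd (Q : ℕ)) {α' : Type*}
    (K : α' → ZMod (phi8fLine n D p₁ Q bstar vstar).N → ℂ)
    (x' : α') (u' : Fin n → ZMod (phi8fLine n D p₁ Q bstar vstar).N) :
    ‖qftTail (fun z : α' × (Fin n → ZMod (phi8fLine n D p₁ Q bstar vstar).N) =>
          ∑ x, K z.1 x * splitFirst (phi8fLine n D p₁ Q bstar vstar).ket (x, z.2)) (x', u')‖ ^ 2
      = ‖∑ x, K x' x * (phi8fCertificate n D p₁ Q bstar vstar cop hhead htail).headKet x‖ ^ 2 * Q := by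
  rw [Certificate.qftTail_processed (phi8fCertificate n D p₁ Q bstar vstar cop hhead htail) K x' u',
    norm_mul, mul_pow, tail_fourier_norm_sq n D p₁ Q bstar vstar cop hhead htail hQ u']

end OutputLaw

namespace Shape

variable (S : Shape)

/-- **The output law of Step 9 (any processing of coordinate 0).**  For every admissible shape and
every kernel `K : α' × ℤ_N → ℂ` acting on coordinate 0 of `|φ8.f⟩` (absorbing Chen's (9.e)–(9.g), any
replacement of them, and the coordinate-0 factor of the final `QFT`), the unnormalised Born weight of
the outcome `(x', u')` after `QFT_{ℤ_Nⁿ}` on coordinates `1..n` is `w(x') · Q` — INDEPENDENT of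
`u' = u[1..n]`: the register `u[1..n]` is exactly uniform and independent of register 0
(`STEPS.md` §4.4(c); `REPAIR-CENSUS.md` T2).  In particular no event depending non-trivially on `u'`
— such as eq. (41) modulo `Q` — has probability 1, contrary to Lemma 3.8 as printed.
[cite: ChenQuantumLattice2024, Lemma 3.8 and eq. (41) p. 38] -/
theorem outputWeight_eq (h : S.Admissible) {α' : Type*} (K : α' → ZMod S.N → ℂ) :
    ∃ w : α' → ℝ, ∀ (x' : α') (u' : Fin S.n → ZMod S.N),
      ‖qftTail (fun z : α' × (Fin S.n → ZMod S.N) => ∑ x, K z.1 x * splitFirst S.phi8f (x, z.2))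
          (x', u')‖ ^ 2 = w x' * S.Q := by
  have hhead : ((S.Q : ℕ+) : ℤ) ∣ S.bstar 0 := by rw [h.bstar_head]
  refine ⟨fun x' => ‖∑ x, K x' x
      * (phi8fCertificate S.n S.D S.p₁ S.Q S.bstar S.vstar h.cop_pQ hhead h.bstar_tail).headKet x‖ ^ 2,
    fun x' u' => ?_⟩
  rw [S.phi8f_eq_ket]
  exact phi8fLine_outputWeight S.n S.D S.p₁ S.Q S.bstar S.vstar h.cop_pQ hhead h.bstar_tail h.odd_Q
    K x' u'

/-- Corollary: the weight does not depend on `u'` at all. [cite: ChenQuantumLattice2024, Lemma 3.8 p. 38] -/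
theorem outputWeight_indep (h : S.Admissible) {α' : Type*} (K : α' → ZMod S.N → ℂ) (x' : α')
    (u' u'' : Fin S.n → ZMod S.N) :
    ‖qftTail (fun z : α' × (Fin S.n → ZMod S.N) => ∑ x, K z.1 x * splitFirst S.phi8f (x, z.2))
        (x', u')‖ ^ 2
      = ‖qftTail (fun z : α' × (Fin S.n → ZMod S.N) => ∑ x, K z.1 x * splitFirst S.phi8f (x, z.2))
        (x', u'')‖ ^ 2 := by
  obtain ⟨w, hw⟩ := S.outputWeight_eq h K
  rw [hw, hw]

end Shape

/-! ### Link with the full `QFT` of `ChenQuantumLWESteps` -/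

/-- The full `QFT_{ℤ_N^{n+1}}` (`qft`, Lemma 2.12) splits as the coordinate-0 Fourier kernel followed
by `qftTail`: `⟨u₀,u'| QFT ψ⟩ = qftTail (K₀ ψ) (u₀,u')` with `K₀ u₀ x = e(-x u₀/N)`.  So `Shape.outputWeight_eq`
with `K := K₀ ∘ (processing)` covers Chen's (9.h). [cite: ChenQuantumLattice2024, Lemma 2.12 p. 12] -/
theorem splitFirst_qft {n N : ℕ} [NeZero N] (ψ : Ket (n + 1) N) (u₀ : ZMod N) (u' : Fin n → ZMod N) :
    splitFirst (qft ψ) (u₀, u')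
      = qftTail (fun z : ZMod N × (Fin n → ZMod N) =>
          ∑ x : ZMod N, e (-(((x.val * z.1.val : ℕ) : ℚ) / N)) * splitFirst ψ (x, z.2)) (u₀, u') := by
  have rhs : qftTail (fun z : ZMod N × (Fin n → ZMod N) =>
          ∑ x : ZMod N, e (-(((x.val * z.1.val : ℕ) : ℚ) / N)) * splitFirst ψ (x, z.2)) (u₀, u')
      = ∑ y : Fin n → ZMod N, ∑ x : ZMod N, ψ (Fin.cons x y)
          * (e (-(((x.val * u₀.val : ℕ) : ℚ) / N)) * e (-(((dotVal y u' : ℕ) : ℚ) / N))) := by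
    simp only [qftTail, splitFirst, Finset.sum_mul]
    refine Finset.sum_congr rfl fun y _ => Finset.sum_congr rfl fun x _ => ?_
    ring
  rw [rhs, Finset.sum_comm, ← Fintype.sum_prod_type']
  show qft ψ (Fin.cons u₀ u') = _
  unfold qft
  rw [← (Fin.consEquiv fun _ => ZMod N).sum_comp]
  refine Finset.sum_congr rfl fun xy _ => ?_
  simp only [Fin.consEquiv_apply]
  congr 1
  rw [← e_add]
  congr 1
  rw [Fin.sum_univ_succ]
  simp only [Fin.cons_zero, Fin.cons_succ, dotVal]
  push_cast
  ring

end Literature.Computability.Cryptography.Chen2024
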